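import Summits.Ventures.Crystal3D.Theorems.StickyWulffConstantGenericWallFloorStackLedgerOneSidedReach
import Summits.Ventures.Crystal3D.Theorems.StickyWulffConstantGenericWallFloorBarlowOrbitFree
import Summits.Ventures.Crystal3D.Theorems.StickyWulffConstantTextureLiminfBarlowSealing
import HarnessLib

/-!
# Ends of plate-launched walkers in a Barlow|Barlow wall cell lie in the payer window (F4, G-side: «ends ∈ PAY»)
# (crux `GenericWallFloor`, stmt-Ventures-19480, line `WallLedgerG`; lane T's F4, cf-p1 §86(58) BA)

HONEST FRAMING. Venture `Summits/Ventures/Crystal3D` (cell `crystal3d-full`), helper `--supports` the crux `GenericWallFloor`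
(stmt-Ventures-19480) of `route-Ventures-StickyWulffConstant`, registered line `WallLedgerG`, open stub `stub_twoSlabAdhesion`.
Rung credit only; F-C1 not moved; NOT the stub.

In the cell of `BilayerWallAt` (lane T) the payers are `PAY = {y ∈ X : deg y ≠ 12, −R₀−2 ≤ y₂ ≤ h+R₀+2}`
(`walkerFamilies_card_le_payers`).  For a walker of the BOTTOM family (vertical `e₃`) started at a valid state `s` whose ball lies
in grain 1's reach set, this file shows that its end ball `y = (walkRun X e₃ N s).1` is a payer, from three inputs:
(i) NOT HIGH — `y` stays in the reach set (`walkRun_fst_mem_reachSet`), which misses the top plate's stacking (`hoff`, the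
off-registry hypothesis), its lateral radius is `≤ ρ − 1` by the cone bound of `stackWalk_end` (drift `≤ (8/3)·rise ≤ (8/3)(h+4R₀)`)
when the start is that far inside, so the Barlow SEALING of the top plate (`stacking_sealing_above`, wulff-p2 p640484) forbids
`y₂ ≥ h+R₀+1`; (ii) NOT LOW — heights never decrease (`walkRun_height_ge_of_le`: the end is at least as high as any earlier
state, e.g. the exit state of the prefix lemma, which the caller places above `−R₀−2`); (iii) `deg y ≤ 11` (`stackWalk_end`).

* `walkRun_height_ge_of_le` — `n ≤ N ⇒ ⟪(walkRun n s).1, z⟫ ≤ ⟪(walkRun N s).1, z⟫`;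
* **`walkEnd_not_high_barlow`** — `y ∈ X`, `deg y ≤ 11`, `y₀² + y₁² ≤ (ρ−1)²`, `y₂ < h + R₀ + 1`;
* **`walkEnd_mem_PAY_barlow`** — with `−R₀−2 ≤ y₂` supplied: `y ∈ PAY`.
The TOP family is the same statement for the mirrored cell (F4's bookkeeping).
WHAT THIS IS NOT: not F4 (no count, no injectivity — those are `…BarlowWindowFamily`, `…TextureLiminfFluxCount`); F-C1 not moved.
-/

noncomputable section

namespace Summit.Ventures.Crystal3D.Theorems

open Finset
open Literature.MathematicalPhysics.StatisticalMechanics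
open Summit.Ventures.Crystal3D.Cruxes.TextureLiminf.TexShadow (stacking)
open scoped InnerProductSpace

variable {X : Finset (EuclideanSpace ℝ (Fin 3))}

/-- **Heights never decrease (two-time form).**  For a valid state `s` and `n ≤ N`: the `z`-height at time `N` is at least the
`z`-height at time `n`. -/
theorem walkRun_height_ge_of_le (hX : ∀ p ∈ X, ∀ q ∈ X, p ≠ q → 1 ≤ dist p q)
    {s₀ : EuclideanSpace ℝ (Fin 3)} (hs₀ : s₀ ∈ fccSlots) (hcert : ExactOnly 0 (fccSlots.filter fun w => 0 < ⟪w, s₀⟫_ℝ))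
    {z : EuclideanSpace ℝ (Fin 3)} (hz : ‖z‖ = 1) {s : EuclideanSpace ℝ (Fin 3) × List WalkEntry}
    (hI : WalkInv X z s) (hW : StackWF z s.2) {n N : ℕ} (hnN : n ≤ N) :
    ⟪(walkRun X z n s).1, z⟫_ℝ ≤ ⟪(walkRun X z N s).1, z⟫_ℝ := by
  obtain ⟨d, rfl⟩ := Nat.exists_eq_add_of_le hnN
  rw [walkRun_add']
  exact walkRun_height_ge hX hs₀ hcert hz d _ (walkRun_valid hX hs₀ hcert hz n hI hW).1

/-- **The end of a bottom-family walker is not high** (and is laterally inside).  Cell: `X` `1`-separated in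
`[−2R₀, h+2R₀] × {lat ≤ ρ}`, top plate `P₂ = stacking L₂ s₂ σ₂ ∩ [h+R₀, h+2R₀] × {lat ≤ ρ} ⊆ X` (`σ₂` Hägg); walker: a valid
`e₃`-state `s` over the bottom entry `b`, frames of sound stacks over `b` in `M₁`, `s.1 ∈ reachSet L₁ t₁ M₁`, the reach set
missing the top stacking (`hoff`), start at lateral radius `≤ ρ − 1 − (8/3)(h + 4R₀)`, fuel `N`.  Then the end ball is in `X`,
has `≤ 11` contacts, lateral size `≤ (ρ−1)²` and height `< h + R₀ + 1`. -/
theorem walkEnd_not_high_barlow (hX : ∀ p ∈ X, ∀ q ∈ X, p ≠ q → 1 ≤ dist p q)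
    {s₀ : EuclideanSpace ℝ (Fin 3)} (hs₀ : s₀ ∈ fccSlots) (hcert : ExactOnly 0 (fccSlots.filter fun w => 0 < ⟪w, s₀⟫_ℝ))
    {σ₂ : ℤ → ℤ} (hσ₂ : IsHaggSeq σ₂) (L₁ L₂ : EuclideanSpace ℝ (Fin 3) ≃ₗᵢ[ℝ] EuclideanSpace ℝ (Fin 3))
    (t₁ s₂ : EuclideanSpace ℝ (Fin 3)) (R₀ h ρ : ℝ) (hρ : 1 ≤ ρ)
    (P₂ : Finset (EuclideanSpace ℝ (Fin 3))) (hP₂X : P₂ ⊆ X)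
    (hcell : ∀ p ∈ X, -(2 * R₀) ≤ p 2 ∧ p 2 ≤ h + 2 * R₀ ∧ p 0 ^ 2 + p 1 ^ 2 ≤ ρ ^ 2)
    (hP₂ : ∀ p, p ∈ P₂ ↔ (p ∈ stacking L₂ s₂ σ₂ ∧ h + R₀ ≤ p 2 ∧ p 2 ≤ h + 2 * R₀ ∧ p 0 ^ 2 + p 1 ^ 2 ≤ ρ ^ 2))
    (M₁ : Set (EuclideanSpace ℝ (Fin 3) ≃ₗᵢ[ℝ] EuclideanSpace ℝ (Fin 3))) {b : WalkEntry}
    (hM₁ : ∀ stk : List WalkEntry, StackSound (EuclideanSpace.single (2 : Fin 3) (1 : ℝ)) stk →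
      StackWF (EuclideanSpace.single (2 : Fin 3) (1 : ℝ)) stk → stk.getLast? = some b → ∀ e ∈ stk, e.frame ∈ M₁)
    (hoff : ∀ y ∈ reachSet L₁ t₁ M₁, y ∉ stacking L₂ s₂ σ₂)
    {s : EuclideanSpace ℝ (Fin 3) × List WalkEntry}
    (hI : WalkInv X (EuclideanSpace.single (2 : Fin 3) (1 : ℝ)) s)
    (hW : StackWF (EuclideanSpace.single (2 : Fin 3) (1 : ℝ)) s.2) (hlast : s.2.getLast? = some b)
    (hreach : s.1 ∈ reachSet L₁ t₁ M₁)
    (hlat : Real.sqrt (s.1 0 ^ 2 + s.1 1 ^ 2) + 8 / 3 * (h + 4 * R₀) ≤ ρ - 1)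
    {N : ℕ} (hN : 8 * (h + 2 * R₀ - ⟪s.1, EuclideanSpace.single (2 : Fin 3) (1 : ℝ)⟫_ℝ) < 3 * N) :
    (walkRun X (EuclideanSpace.single (2 : Fin 3) (1 : ℝ)) N s).1 ∈ X ∧
      (X.filter fun q => dist (walkRun X (EuclideanSpace.single (2 : Fin 3) (1 : ℝ)) N s).1 q = 1).card ≤ 11 ∧
      (walkRun X (EuclideanSpace.single (2 : Fin 3) (1 : ℝ)) N s).1 0 ^ 2 +
          (walkRun X (EuclideanSpace.single (2 : Fin 3) (1 : ℝ)) N s).1 1 ^ 2 ≤ (ρ - 1) ^ 2 ∧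
      (walkRun X (EuclideanSpace.single (2 : Fin 3) (1 : ℝ)) N s).1 2 < h + R₀ + 1 := by
  set e₃ : EuclideanSpace ℝ (Fin 3) := EuclideanSpace.single (2 : Fin 3) (1 : ℝ) with he₃
  have he₃n : ‖e₃‖ = 1 := by rw [he₃, PiLp.norm_single, norm_one]
  have he₃i : ∀ d : EuclideanSpace ℝ (Fin 3), ⟪d, e₃⟫_ℝ = d 2 := fun d => by
    rw [he₃, EuclideanSpace.inner_single_right]; simp
  have hH : ∀ p ∈ X, ⟪p, e₃⟫_ℝ ≤ h + 2 * R₀ := fun p hp => by rw [he₃i]; exact (hcell p hp).2.1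
  obtain ⟨hyX, hydeg, hrise, hcone, -, -⟩ := stackWalk_end hX hs₀ hcert he₃n hH hI hN
  set y := (walkRun X e₃ N s).1 with hy
  -- the drift bound
  have hs1X : s.1 ∈ X := hI.1
  have hrise' : ⟪y - s.1, e₃⟫_ℝ ≤ h + 4 * R₀ := by
    rw [inner_sub_left, he₃i, he₃i]
    have h1 := (hcell y hyX).2.1; have h2 := (hcell s.1 hs1X).1
    linarith
  have hdrift : ‖y - s.1‖ ≤ 8 / 3 * (h + 4 * R₀) := hcone.trans (by nlinarith)
  -- lateral radius of the end
  have hlat_y : Real.sqrt (y 0 ^ 2 + y 1 ^ 2) ≤ ρ - 1 := by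
    have h1 := sqrt_lateral_add_le s.1 (y - s.1)
    rw [add_sub_cancel] at h1
    linarith
  have hlat_y2 : y 0 ^ 2 + y 1 ^ 2 ≤ (ρ - 1) ^ 2 := by
    have h0 : 0 ≤ y 0 ^ 2 + y 1 ^ 2 := by positivity
    have h7 := pow_le_pow_left₀ (Real.sqrt_nonneg (y 0 ^ 2 + y 1 ^ 2)) hlat_y 2
    rwa [Real.sq_sqrt h0] at h7
  -- the end stays in grain 1's reach set, hence off the top stacking
  have hyreach : y ∈ reachSet L₁ t₁ M₁ := walkRun_fst_mem_reachSet hX hs₀ hcert he₃n hM₁ N s hI hW hlast hreach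
  have hyP₂ : y ∉ P₂ := fun hyP => hoff y hyreach ((hP₂ y).1 hyP).1
  refine ⟨hyX, hydeg, hlat_y2, ?_⟩
  by_contra hhigh
  push Not at hhigh
  exact stacking_sealing_above hσ₂ L₂ s₂ (h + R₀) (h + 2 * R₀) ρ hρ X P₂ hX hP₂X hP₂ y hyX hyP₂ hhigh (hcell y hyX).2.1 hlat_y2

open scoped Classical in
/-- **Ends are payers.**  Under the hypotheses of `walkEnd_not_high_barlow` and `−R₀−2 ≤ y₂` (the exit of the prefix lemma):
the end ball lies in `PAY = {y ∈ X : deg y ≠ 12, −R₀−2 ≤ y₂ ≤ h+R₀+2}`. -/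
theorem walkEnd_mem_PAY_barlow (hX : ∀ p ∈ X, ∀ q ∈ X, p ≠ q → 1 ≤ dist p q)
    {s₀ : EuclideanSpace ℝ (Fin 3)} (hs₀ : s₀ ∈ fccSlots) (hcert : ExactOnly 0 (fccSlots.filter fun w => 0 < ⟪w, s₀⟫_ℝ))
    {σ₂ : ℤ → ℤ} (hσ₂ : IsHaggSeq σ₂) (L₁ L₂ : EuclideanSpace ℝ (Fin 3) ≃ₗᵢ[ℝ] EuclideanSpace ℝ (Fin 3))
    (t₁ s₂ : EuclideanSpace ℝ (Fin 3)) (R₀ h ρ : ℝ) (hρ : 1 ≤ ρ)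
    (P₂ : Finset (EuclideanSpace ℝ (Fin 3))) (hP₂X : P₂ ⊆ X)
    (hcell : ∀ p ∈ X, -(2 * R₀) ≤ p 2 ∧ p 2 ≤ h + 2 * R₀ ∧ p 0 ^ 2 + p 1 ^ 2 ≤ ρ ^ 2)
    (hP₂ : ∀ p, p ∈ P₂ ↔ (p ∈ stacking L₂ s₂ σ₂ ∧ h + R₀ ≤ p 2 ∧ p 2 ≤ h + 2 * R₀ ∧ p 0 ^ 2 + p 1 ^ 2 ≤ ρ ^ 2))
    (M₁ : Set (EuclideanSpace ℝ (Fin 3) ≃ₗᵢ[ℝ] EuclideanSpace ℝ (Fin 3))) {b : WalkEntry}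
    (hM₁ : ∀ stk : List WalkEntry, StackSound (EuclideanSpace.single (2 : Fin 3) (1 : ℝ)) stk →
      StackWF (EuclideanSpace.single (2 : Fin 3) (1 : ℝ)) stk → stk.getLast? = some b → ∀ e ∈ stk, e.frame ∈ M₁)
    (hoff : ∀ y ∈ reachSet L₁ t₁ M₁, y ∉ stacking L₂ s₂ σ₂)
    {s : EuclideanSpace ℝ (Fin 3) × List WalkEntry}
    (hI : WalkInv X (EuclideanSpace.single (2 : Fin 3) (1 : ℝ)) s)
    (hW : StackWF (EuclideanSpace.single (2 : Fin 3) (1 : ℝ)) s.2) (hlast : s.2.getLast? = some b)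
    (hreach : s.1 ∈ reachSet L₁ t₁ M₁)
    (hlat : Real.sqrt (s.1 0 ^ 2 + s.1 1 ^ 2) + 8 / 3 * (h + 4 * R₀) ≤ ρ - 1)
    {N : ℕ} (hN : 8 * (h + 2 * R₀ - ⟪s.1, EuclideanSpace.single (2 : Fin 3) (1 : ℝ)⟫_ℝ) < 3 * N)
    (hlow : -R₀ - 2 ≤ (walkRun X (EuclideanSpace.single (2 : Fin 3) (1 : ℝ)) N s).1 2) :
    (walkRun X (EuclideanSpace.single (2 : Fin 3) (1 : ℝ)) N s).1 ∈
      X.filter fun y => (X.filter fun q => dist y q = 1).card ≠ 12 ∧ -R₀ - 2 ≤ y 2 ∧ y 2 ≤ h + R₀ + 2 := by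
  obtain ⟨hyX, hydeg, -, hhigh⟩ := walkEnd_not_high_barlow hX hs₀ hcert hσ₂ L₁ L₂ t₁ s₂ R₀ h ρ hρ P₂ hP₂X hcell hP₂ M₁
    hM₁ hoff hI hW hlast hreach hlat hN
  rw [Finset.mem_filter]
  exact ⟨hyX, by omega, hlow, by linarith⟩

end Summit.Ventures.Crystal3D.Theorems

end
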